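import Summits.HubbardSuperconductivity.HubbardSuperconductivity.Theorems.FunctionFieldCertificateWindowInfraredBoundFreeOrthogonalModeSum
import Literature.MathematicalPhysics.QuantumLattice.ApproximateEigenvectorLemmas

/-!
# Crux `WindowInfraredBound` (stmt-HubbardSuperconductivity-1089) — the free point `U = 0`, stub S4b:
# the triangle bound for a sum of Bloch pair modes over a thin Fermi shell

Support of the R4 calibration `FreeWindowBoundAllGroundStates` (line `free-window-calibration`, skeleton
`Cruxes/WindowInfraredBound/Lines/free_window_calibration.lean`). For the Bloch pair modes
`B_m(k) = c_{(m−k)↓} c_{k↑} = momentumAnnihilation (m - k) 1 * momentumAnnihilation k 0` of the fermionic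
torus `(ℤ/Lℤ)²`, an ARBITRARY vector `ψ`, and coefficients with `|A(k)|² ≤ a` on a finite set `K` of momenta:

* `ftm_eucNorm_sum_le` — the triangle inequality `‖Σ_{i∈s} v_i‖ ≤ Σ_{i∈s} ‖v_i‖` for `eucNorm`;
* `ftm_eucNorm_pairMode_mulVec_le` — pair modes are contractions, `‖B_m(k) ψ‖ ≤ ‖ψ‖` (every Bloch
  annihilator is one: `‖c_{pσ} w‖² = Re⟨w, n_{pσ} w⟩ ≤ ‖w‖²`, the occupation number `n_{pσ} = c†c` being an
  orthogonal projection; tree `fom_re_pairMode_mem_Icc` of the sibling stub file);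
* `stub_freeTriangleModeSum` (registered stub of the skeleton) —
  `‖Σ_{k∈K} A(k) B_m(k) ψ‖ ≤ Σ_{k∈K} |A(k)| ‖B_m(k)ψ‖ ≤ √a · #K · ‖ψ‖`.

Sources: J. Bardeen, L. N. Cooper, J. R. Schrieffer, Phys. Rev. 108 (1957) 1175, §II (the pair modes);
O. Bratteli, D. W. Robinson, *Operator Algebras and Quantum Statistical Mechanics 2*, §5.2.1
(`‖a(f)‖ ≤ ‖f‖` in the CAR algebra). Folklore finite-dimensional statements over the tree's definitions;
no definition and no named fact is introduced.
-/

noncomputable section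

set_option linter.dupNamespace false

namespace Summit.HubbardSuperconductivity.HubbardSuperconductivity.Theorems.WindowInfraredBound

open Matrix Finset
open Literature.Probability.LatticeModels Literature.MathematicalPhysics.QuantumLattice
open scoped ComplexOrder ComplexConjugate

/-! ### Euclidean-norm bookkeeping -/

/-- **Triangle inequality over a finite sum**: `‖Σ_{i∈s} v_i‖ ≤ Σ_{i∈s} ‖v_i‖` for the Euclidean norm
of coordinate vectors. [folklore] -/
theorem ftm_eucNorm_sum_le {n : Type*} [Fintype n] {ι : Type*} (s : Finset ι) (v : ι → n → ℂ) :
    eucNorm (∑ i ∈ s, v i) ≤ ∑ i ∈ s, eucNorm (v i) := by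
  classical
  induction s using Finset.induction_on with
  | empty => simp
  | insert a s ha ih =>
    rw [Finset.sum_insert ha, Finset.sum_insert ha]
    exact (eucNorm_add_le _ _).trans (by linarith)

/-- `|c| ≤ √a` whenever `|c|² ≤ a`. [folklore] -/
theorem ftm_norm_le_sqrt {c : ℂ} {a : ℝ} (h : ‖c‖ ^ 2 ≤ a) : ‖c‖ ≤ Real.sqrt a :=
  Real.le_sqrt_of_sq_le h

/-! ### Bloch annihilators and pair modes are contractions -/

section Contractions

variable {L : ℕ} [NeZero L]

/-- **Pair modes are contractions**: `‖c_{(m−k)↓} c_{k↑} ψ‖ ≤ ‖ψ‖` (each Bloch annihilator is a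
contraction, `‖c_{pσ} w‖² = Re⟨w, n_{pσ} w⟩ ≤ ‖w‖²`; tree: `fom_re_pairMode_mem_Icc`).
Bardeen–Cooper–Schrieffer, Phys. Rev. 108 (1957) 1175, §II; Bratteli–Robinson, *OAQSM 2* §5.2.1. [folklore] -/
theorem ftm_eucNorm_pairMode_mulVec_le (m k : TorusSite 2 L) (ψ : Fock (Orb (FermionTorus 2 L))) :
    eucNorm ((momentumAnnihilation (m - k) 1 * momentumAnnihilation k 0) *ᵥ ψ) ≤ eucNorm ψ := by
  refine le_of_pow_le_pow_left₀ two_ne_zero (eucNorm_nonneg ψ) ?_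
  rw [eucNorm_sq, eucNorm_sq]
  exact (fom_re_pairMode_mem_Icc m k ψ).2

/-- One weighted pair mode: `‖A • B_m(k) ψ‖ ≤ √a ‖ψ‖` when `|A|² ≤ a`. [folklore] -/
theorem ftm_eucNorm_smul_pairMode_mulVec_le (m k : TorusSite 2 L) {A : ℂ} {a : ℝ} (hA : ‖A‖ ^ 2 ≤ a)
    (ψ : Fock (Orb (FermionTorus 2 L))) :
    eucNorm (A • ((momentumAnnihilation (m - k) 1 * momentumAnnihilation k 0) *ᵥ ψ)) ≤
      Real.sqrt a * eucNorm ψ := by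
  rw [eucNorm_smul]
  exact mul_le_mul (ftm_norm_le_sqrt hA) (ftm_eucNorm_pairMode_mulVec_le m k ψ) (eucNorm_nonneg _)
    (Real.sqrt_nonneg _)

end Contractions

/-! ### The registered stub -/

/-- **Stub S4b — triangle bound for a sum of pair modes (thin Fermi shell).** For the Bloch pair modes
`B_m(k) = c_{(m−k)↓} c_{k↑}`, any finite set `K` of momenta, any vector `ψ` and coefficients with
`|A(k)|² ≤ a` on `K`:
`‖Σ_{k∈K} A(k) B_m(k) ψ‖ ≤ Σ_{k∈K} |A(k)| ‖B_m(k) ψ‖ ≤ √a · #K · ‖ψ‖`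
(triangle inequality; `|A(k)| ≤ √a`; each `B_m(k)` is a product of two contractions `c_{pσ}`,
`‖c_{pσ} w‖² = Re⟨w, n_{pσ} w⟩ ≤ ‖w‖²`). The hypothesis `0 ≤ a` is not needed (it follows from
`|A(k)|² ≤ a` when `K ≠ ∅`, and both sides vanish when `K = ∅`) but is kept as registered.
Bardeen–Cooper–Schrieffer, Phys. Rev. 108 (1957) 1175, §II; Bratteli–Robinson, *OAQSM 2* §5.2.1. [folklore] -/
theorem stub_freeTriangleModeSum : ∀ (L : ℕ) [NeZero L] (m : TorusSite 2 L) (A : TorusSite 2 L → ℂ)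
    (a : ℝ) (K : Finset (TorusSite 2 L)) (ψ : Fock (Orb (FermionTorus 2 L))), 0 ≤ a →
    (∀ k ∈ K, ‖A k‖ ^ 2 ≤ a) →
    eucNorm ((∑ k ∈ K, A k • (momentumAnnihilation (m - k) 1 * momentumAnnihilation k 0)) *ᵥ ψ) ≤
      Real.sqrt a * K.card * eucNorm ψ := by
  intro L _ m A a K ψ _ hA
  -- the weighted mode vectors `v k = A(k) • B_m(k) ψ`
  set v : TorusSite 2 L → Fock (Orb (FermionTorus 2 L)) :=
    fun k => A k • ((momentumAnnihilation (m - k) 1 * momentumAnnihilation k 0) *ᵥ ψ)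
  have hv : (∑ k ∈ K, A k • (momentumAnnihilation (m - k) 1 * momentumAnnihilation k 0)) *ᵥ ψ =
      ∑ k ∈ K, v k := by
    rw [Matrix.sum_mulVec]
    exact Finset.sum_congr rfl fun k _ => Matrix.smul_mulVec _ _ _
  rw [hv]
  calc eucNorm (∑ k ∈ K, v k)
      ≤ ∑ k ∈ K, eucNorm (v k) := ftm_eucNorm_sum_le K v
    _ ≤ ∑ k ∈ K, Real.sqrt a * eucNorm ψ :=
        Finset.sum_le_sum fun k hk => ftm_eucNorm_smul_pairMode_mulVec_le m k (hA k hk) ψ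
    _ = Real.sqrt a * K.card * eucNorm ψ := by
        rw [Finset.sum_const, nsmul_eq_mul]
        ring

end Summit.HubbardSuperconductivity.HubbardSuperconductivity.Theorems.WindowInfraredBound
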